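import Summits.ResolutionOfSingularities.ResolutionOfSingularities.Theses.FrobeniusLadder
import Summits.ResolutionOfSingularities.ResolutionOfSingularities.Theorems.FrobeniusLadderFRationalModificationCertifiedModel
import Summits.ResolutionOfSingularities.ResolutionOfSingularities.Theorems.FrobeniusLadderFRationalModificationReduction
import Summits.ResolutionOfSingularities.ResolutionOfSingularities.Theorems.FrobeniusLadderFRationalModificationCmCartierHull
import Summits.ResolutionOfSingularities.ResolutionOfSingularities.Theorems.FrobeniusLadderFRationalModificationBlowupPrincipalization
import Literature.AlgebraicGeometry.Resolution.CanonicalResolutionProofs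
import Mathlib.AlgebraicGeometry.IdealSheaf.Functorial
import Mathlib.AlgebraicGeometry.FunctionField
import HarnessLib

/-!
# The crux `FRationalModification` from an F-injective Cartier hull ALONE — no Cohen–Macaulay input,
no named fact (crux `FrobeniusLadder.FRationalModification`, line `birth` v3, chain B)

Crux `stmt-ResolutionOfSingularities-15316`, line `birth`: the registered skeleton closes the crux from
(A) a Cohen–Macaulay Cartier hull (Česnavičius's CM principalization of the non-regular locus — a named
fact in print) and (B) the OPEN stub `stub_fInjectiveCartierHull` (F-injectivise a Cartier boundary of a
Cohen–Macaulay ambient keeping regularity off it). This file records that the Cohen–Macaulay input and the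
named fact are CONVENIENCES of that cut, not load-bearing: if the F-injectivisation of a Cartier boundary
is available for an arbitrary INTEGRAL ambient (hypothesis `hFIH` of
`fRationalModification_of_fInjectiveCartierHull`, i.e. the open stub with its Cohen–Macaulay hypothesis
dropped), then the crux follows with NO named fact at all — the Cartier hull is simply the blowing up of
the non-regular locus (`cartierHull_of_blowup`: closed over any field by
`isOpen_regularLocus_of_locallyOfFiniteType_field`; proper birational integral with the exceptional ideal
an effective Cartier divisor and an isomorphism off it by the tree's blow-up API,
`BlowupPrincipalization.stub_blowupPrincipalization`; regular off the divisor by transport along the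
stalk isomorphisms, `CmCartierHull.isIso_stalkMap_of_isIso_morphismRestrict`), and the consumer is the
tree's unconditional Fedder–Watanabe inversion along a Cartier certificate
(`CertifiedModel.rungThree_of_cartierCertificate`). The rung-2 antecedent of the crux is then used only
through `Reduction.stub_reduction` (decomposition of the locally integral model into integral components
and gluing), in line with `Negative.LoadBearing` §1 (the antecedent is idle for the bare implication).

## References

* R. Fedder, K.-i. Watanabe, *A characterization of F-regularity in terms of F-purity*, MSRI Publ. 15
  (1989), Prop. 2.13. [FedderWatanabe1989]
* The Stacks Project, Tags 02ND, 02OS (blowing up), 07QW. [StacksProject]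
* H. Matsumura, *Commutative Ring Theory* (1986), §30, Cor. to Thm. 30.5 (regular locus of a finite
  type algebra over a field is open). [Matsumura1987]
-/

-- single-problem summit: the doubled namespace component `ResolutionOfSingularities` is forced
set_option linter.dupNamespace false

noncomputable section

open CategoryTheory AlgebraicGeometry TopologicalSpace IsLocalRing
open Literature.AlgebraicGeometry.Resolution
open Summit.ResolutionOfSingularities.ResolutionOfSingularities.Theses.FrobeniusLadder

namespace Summit.ResolutionOfSingularities.ResolutionOfSingularities.Theorems.FRationalModification.HullsNoCM

/-- **The Cartier hull of the non-regular locus, Cohen–Macaulay-free.** Every integral `Y` locally of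
finite type over a field `k` has a proper birational INTEGRAL model `π : W → Y` carrying an effective
Cartier divisor `D` such that `W` is regular off `Supp D` and `Supp D = π⁻¹(Y ∖ Reg Y)` lies over the
non-regular locus: blow up the non-regular locus `Y ∖ Reg Y` (closed, Matsumura Cor. to Thm. 30.5; not
all of `Y`, the generic stalk being a field) with its reduced structure; the exceptional ideal is an
effective Cartier divisor, the blow-up is an isomorphism off it, and regularity transports along the
stalk isomorphisms. [cite: StacksProject, Tags 02ND and 02OS; Matsumura1987, §30, Cor. to Thm. 30.5] -/
theorem cartierHull_of_blowup (k : Type) [Field k] (Y : Scheme.{0}) (g : Y ⟶ Spec (.of k))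
    [LocallyOfFiniteType g] [IsIntegral Y] :
    ∃ (W : Scheme.{0}) (π : W ⟶ Y), IsProper π ∧ IsBirational π ∧ IsIntegral W ∧
      ∃ D : W.IdealSheafData, IsEffectiveCartier D ∧
        (∀ w : W, w ∉ D.support → IsRegularLocalRing (W.presheaf.stalk w)) ∧
        (D.support : Set W) = π.base ⁻¹' (Scheme.regularLocus Y)ᶜ := by
  haveI : IsLocallyNoetherian Y := LocallyOfFiniteType.isLocallyNoetherian g
  -- the non-regular locus, as a closed subscheme with its reduced (vanishing-ideal) structure
  have hopen : IsOpen (Scheme.regularLocus Y) := isOpen_regularLocus_of_locallyOfFiniteType_field g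
  let C : Closeds Y := ⟨(Scheme.regularLocus Y)ᶜ, hopen.isClosed_compl⟩
  let Z : Y.IdealSheafData := Scheme.IdealSheafData.vanishingIdeal C
  have hZsupp : (Z.support : Set Y) = (Scheme.regularLocus Y)ᶜ :=
    Scheme.IdealSheafData.coe_support_vanishingIdeal C
  -- it is not everything: the generic point is regular (its stalk is the function field)
  have hξ : genericPoint Y ∈ Scheme.regularLocus Y := by
    change IsRegularLocalRing Y.functionField
    infer_instance
  have hZ : Z.support ≠ ⊤ := by
    intro h
    have : genericPoint Y ∈ (Z.support : Set Y) := by rw [h]; trivial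
    rw [hZsupp] at this
    exact this hξ
  -- blow it up
  obtain ⟨W, π, hπ, hbir, hW, hcart, hiso⟩ :=
    BlowupPrincipalization.stub_blowupPrincipalization Y Z hZ
  refine ⟨W, π, hπ, hbir, hW, Z.comap π, hcart, fun w hw => ?_, ?_⟩
  · -- off `Supp (Z.comap π) = π⁻¹ Supp Z`: `π w` is a regular point …
    have hπw : π.base w ∉ (Z.support : Set Y) := by
      intro h
      apply hw
      rw [Scheme.IdealSheafData.support_comap]
      exact h
    have hreg : IsRegularLocalRing (Y.presheaf.stalk (π.base w)) := by
      rw [hZsupp] at hπw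
      exact not_not.mp hπw
    -- … and `π` is an isomorphism near `w`
    haveI := hiso
    haveI : IsIso (π.stalkMap w) :=
      CmCartierHull.isIso_stalkMap_of_isIso_morphismRestrict π Z.support.compl w hπw
    exact IsRegularLocalRing.of_ringEquiv (asIso (π.stalkMap w)).commRingCatIsoToRingEquiv
  · rw [Scheme.IdealSheafData.support_comap, ← hZsupp]
    rfl

/-- **The crux from the F-injective Cartier hull alone (chain B: no Cohen–Macaulay input, no named
fact).** If every effective Cartier divisor `D` on an INTEGRAL separated finite-type `W/k`
(`char k = p`) with `W` regular off `Supp D` can be replaced, after a proper birational `W' → W`, by an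
effective Cartier `D'` with `W'` regular off `Supp D'` and, along `Supp D'`, domain stalks whose
hypersurface ring `𝒪_{W',w}/D'_w` is Cohen–Macaulay and F-injective (hypothesis `hFIH` — line `birth`'s
open stub `stub_fInjectiveCartierHull` WITHOUT its Cohen–Macaulay hypothesis on `W`), then
`FRationalModification` holds: reduce to an integral component `Y` of the rung-2 model
(`Reduction.stub_reduction`), blow up its non-regular locus (`cartierHull_of_blowup`), F-injectivise the
exceptional boundary (`hFIH`), and conclude rung 3 off the new boundary by regularity
(`Negative.rungThree_of_isRegularLocalRing`) and on it by the Fedder–Watanabe inversion along the Cartier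
certificate (`CertifiedModel.rungThree_of_cartierCertificate`, unconditional over every field).
[cite: FedderWatanabe1989, Prop. 2.13; StacksProject, Tag 02ND] -/
theorem fRationalModification_of_fInjectiveCartierHull
    (hFIH : ∀ (p : ℕ) [Fact p.Prime] (k : Type) [Field k] [CharP k p] (W : Scheme.{0})
      (g : W ⟶ Spec (.of k)) [IsSeparated g] [LocallyOfFiniteType g] [QuasiCompact g] [IsIntegral W]
      (D : W.IdealSheafData), IsEffectiveCartier D →
        (∀ w : W, w ∉ D.support → IsRegularLocalRing (W.presheaf.stalk w)) →
        ∃ (W' : Scheme.{0}) (π : W' ⟶ W), IsProper π ∧ IsBirational π ∧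
          ∃ D' : W'.IdealSheafData, IsEffectiveCartier D' ∧
            (∀ w : W', w ∉ D'.support → IsRegularLocalRing (W'.presheaf.stalk w)) ∧
            (∀ w : W', w ∈ D'.support → IsDomain (W'.presheaf.stalk w) ∧
              ∀ d : ℕ, ringKrullDim (W'.presheaf.stalk w ⧸ stalkIdeal D' w) = d →
                ∀ t : Fin d → W'.presheaf.stalk w ⧸ stalkIdeal D' w,
                  (Ideal.span (Set.range t)).radical.IsMaximal →
                    RingTheory.Sequence.IsWeaklyRegular (W'.presheaf.stalk w ⧸ stalkIdeal D' w)
                      (List.ofFn t) ∧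
                    ∀ y : W'.presheaf.stalk w ⧸ stalkIdeal D' w, (∃ e : ℕ, y ^ p ^ e ∈
                      Ideal.span ((fun z : W'.presheaf.stalk w ⧸ stalkIdeal D' w => z ^ p ^ e) ''
                        (Ideal.span (Set.range t) :
                          Set (W'.presheaf.stalk w ⧸ stalkIdeal D' w)))) →
                      y ∈ Ideal.span (Set.range t))) :
    FRationalModification := by
  intro p hp k _ _ X f hsep hft hqc _ hX₁
  haveI : Fact p.Prime := ⟨hp⟩
  haveI := hsep; haveI := hft; haveI := hqc
  refine Reduction.stub_reduction p k X f (fun Y g hs hl hq hY _ => ?_) hX₁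
  haveI := hs; haveI := hl; haveI := hq; haveI := hY
  -- the Cartier hull of the non-regular locus (a blow-up; no Cohen–Macaulay input)
  obtain ⟨W, π, hπ, hbir, hW, D, hD, hreg, -⟩ := cartierHull_of_blowup k Y g
  haveI := hπ; haveI := hW
  -- the F-injective Cartier hull over it (`W/k` through `π ≫ g`)
  obtain ⟨W', π', hπ', hbir', D', hD', hreg', hcert⟩ := hFIH p k W (π ≫ g) D hD hreg
  haveI := hπ'
  haveI : IsLocallyNoetherian W' := LocallyOfFiniteType.isLocallyNoetherian (π' ≫ π ≫ g)
  refine ⟨W', π' ≫ π, inferInstance, ComponentGluing.IsBirational.comp hbir' hbir, fun w => ?_⟩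
  by_cases hw : w ∈ D'.support
  · -- on the boundary: the Cartier certificate
    obtain ⟨hdom, hc⟩ := hcert w hw
    haveI := hdom
    exact CertifiedModel.rungThree_of_cartierCertificate p k (π' ≫ π ≫ g) hD' hw hreg' hc
  · -- off the boundary: regular, hence rung-3
    haveI : CharP (W'.presheaf.stalk w) p := Negative.charP_stalk (π' ≫ π ≫ g) w
    exact Negative.rungThree_of_isRegularLocalRing hp _ (hreg' w hw)

end Summit.ResolutionOfSingularities.ResolutionOfSingularities.Theorems.FRationalModification.HullsNoCM

end
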